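import Mathlib
import HarnessLib

/-!
# Route OneSlice — support item `BandImpliesThreshold` (stmt-PneNP-2839): binomial bookkeeping

Elementary facts about the binomial weights `b i = C(N,i) p^i (1-p)^{N-i}` (written through a
defining hypothesis `hb : ∀ i, b i = …`, no new definition) used to pass from accuracy on
`G(n,p)` to accuracy on a band of adjacent Hamming slices:

* `binomialWeight_sum_range` — total mass `1` (binomial theorem);
* `binomialWeight_variance` — `∑ (Np - i)² b i = N p (1-p)` (from `bernsteinPolynomial.variance`);
* `binomialWeight_tail_le` — Chebyshev: the mass of `{i : t ≤ |i - Np|}` is `≤ Np(1-p)/t²`;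
* `binomialWeight_succ_mul` and the one-step comparisons `binomialWeight_succ_le_two_mul`,
  `binomialWeight_le_two_mul_succ`, iterated in `binomialWeight_add_le_two_pow_mul`,
  `binomialWeight_le_two_pow_mul_add` (`b j ≤ 2^{|i-j|} b i` on a window around the mean);
* `sum_sum_Icc_le_mul_sum` — double counting of bands `[j-w, j+w]`;
* `exists_mem_band_sum_le` — the weighted-averaging lemma: if the central indices carry mass
  `≥ 1/2` and `b j ≤ K b i` across each band, then `∑ b i f i ≤ ε` forces a central `j` with
  `∑_{i ∈ [j-w, j+w]} f i ≤ 2 K (2w+1) ε`.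

References: textbook (Chebyshev's inequality for the binomial law; e.g. S. Jukna, *Extremal
Combinatorics*, 2nd ed. 2011, §18); B. Rossman, FOCS 2010 §9 (the single-threshold question this
rung of route PneNP/OneSlice feeds).
-/

set_option linter.dupNamespace false -- `Summit.PneNP.PneNP.…`: summit = sub-problem (D-0017)

namespace Summit.PneNP.PneNP.Theorems

open Finset

section Binomial

variable {N : ℕ} {p : ℝ} {b : ℕ → ℝ}

/-- Total mass of the binomial weights: `∑_{i ≤ N} C(N,i) p^i (1-p)^{N-i} = 1`. [folklore] -/
theorem binomialWeight_sum_range (hb : ∀ i, b i = (N.choose i : ℝ) * p ^ i * (1 - p) ^ (N - i)) :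
    ∑ i ∈ range (N + 1), b i = 1 := by
  have h := add_pow p (1 - p) N
  rw [add_sub_cancel, one_pow] at h
  rw [h]
  exact sum_congr rfl fun i _ => by rw [hb i]; ring

/-- The binomial weights are nonnegative for `p ∈ [0,1]`. [folklore] -/
theorem binomialWeight_nonneg (hb : ∀ i, b i = (N.choose i : ℝ) * p ^ i * (1 - p) ^ (N - i))
    (hp0 : 0 ≤ p) (hp1 : p ≤ 1) (i : ℕ) : 0 ≤ b i := by
  rw [hb i]
  exact mul_nonneg (mul_nonneg (Nat.cast_nonneg _) (pow_nonneg hp0 _))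
    (pow_nonneg (sub_nonneg.2 hp1) _)

/-- Variance of the binomial law: `∑_{i ≤ N} (Np - i)² C(N,i) p^i (1-p)^{N-i} = N p (1 - p)`
(evaluation of `bernsteinPolynomial.variance`). [folklore] -/
theorem binomialWeight_variance (hb : ∀ i, b i = (N.choose i : ℝ) * p ^ i * (1 - p) ^ (N - i)) :
    ∑ i ∈ range (N + 1), ((N : ℝ) * p - i) ^ 2 * b i = N * p * (1 - p) := by
  have h := congrArg (Polynomial.eval p) (bernsteinPolynomial.variance ℝ N)
  simp only [Polynomial.eval_finsetSum, Polynomial.eval_mul, Polynomial.eval_pow,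
    Polynomial.eval_sub, nsmul_eq_mul, Polynomial.eval_natCast, Polynomial.eval_X,
    Polynomial.eval_one, bernsteinPolynomial] at h
  rw [← h]
  exact sum_congr rfl fun i _ => by rw [hb i]

/-- **Chebyshev's inequality for the binomial law**: the weights of the indices at distance `≥ t`
from the mean `Np` sum to at most `N p (1-p) / t²`. [folklore] -/
theorem binomialWeight_tail_le (hb : ∀ i, b i = (N.choose i : ℝ) * p ^ i * (1 - p) ^ (N - i))
    (hp0 : 0 ≤ p) (hp1 : p ≤ 1) {t : ℝ} (ht : 0 < t) (P : ℕ → Prop) [DecidablePred P]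
    (hP : ∀ i, P i → t ≤ |(i : ℝ) - N * p|) :
    ∑ i ∈ (range (N + 1)).filter P, b i ≤ N * p * (1 - p) / t ^ 2 := by
  rw [le_div_iff₀ (pow_pos ht 2), ← binomialWeight_variance hb, sum_mul]
  calc ∑ i ∈ (range (N + 1)).filter P, b i * t ^ 2
      ≤ ∑ i ∈ (range (N + 1)).filter P, ((N : ℝ) * p - i) ^ 2 * b i := by
        refine sum_le_sum fun i hi => ?_
        have hPi : P i := (mem_filter.1 hi).2
        have h1 : t ^ 2 ≤ ((N : ℝ) * p - i) ^ 2 := by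
          have h2 : t ^ 2 ≤ |(i : ℝ) - N * p| ^ 2 := pow_le_pow_left₀ ht.le (hP i hPi) 2
          rw [sq_abs] at h2
          nlinarith [h2]
        rw [mul_comm]
        exact mul_le_mul_of_nonneg_right h1 (binomialWeight_nonneg hb hp0 hp1 i)
    _ ≤ ∑ i ∈ range (N + 1), ((N : ℝ) * p - i) ^ 2 * b i :=
        sum_le_sum_of_subset_of_nonneg (filter_subset _ _) fun i _ _ =>
          mul_nonneg (sq_nonneg _) (binomialWeight_nonneg hb hp0 hp1 i)

/-- The ratio of consecutive binomial weights: `b (i+1) · (i+1)(1-p) = b i · (N-i) p` for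
`i + 1 ≤ N` (from `C(N,i+1)(i+1) = C(N,i)(N-i)`). [folklore] -/
theorem binomialWeight_succ_mul (hb : ∀ i, b i = (N.choose i : ℝ) * p ^ i * (1 - p) ^ (N - i))
    {i : ℕ} (hi : i + 1 ≤ N) :
    b (i + 1) * ((i + 1 : ℝ) * (1 - p)) = b i * (((N : ℝ) - i) * p) := by
  have h := Nat.choose_succ_right_eq N i
  have h' : (N.choose (i + 1) : ℝ) * ((i : ℝ) + 1) = (N.choose i : ℝ) * ((N : ℝ) - i) := by
    have := congrArg (Nat.cast (R := ℝ)) h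
    push_cast [Nat.cast_sub (show i ≤ N by omega)] at this
    exact this
  have hN : N - i = (N - (i + 1)) + 1 := by omega
  rw [hb, hb, hN, pow_succ, pow_succ]
  linear_combination (p ^ i * p * (1 - p) ^ (N - (i + 1)) * (1 - p)) * h'

/-- One step up: if `(N-i) p ≤ 2 (i+1)(1-p)` then `b (i+1) ≤ 2 b i`. [folklore] -/
theorem binomialWeight_succ_le_two_mul
    (hb : ∀ i, b i = (N.choose i : ℝ) * p ^ i * (1 - p) ^ (N - i)) (hp0 : 0 ≤ p) (hp1 : p < 1)
    {i : ℕ} (hi : i + 1 ≤ N) (h : ((N : ℝ) - i) * p ≤ 2 * ((i + 1 : ℝ) * (1 - p))) :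
    b (i + 1) ≤ 2 * b i := by
  have hA : 0 < (i + 1 : ℝ) * (1 - p) := mul_pos (by positivity) (by linarith)
  have hbi : 0 ≤ b i := binomialWeight_nonneg hb hp0 hp1.le i
  have key := binomialWeight_succ_mul hb hi
  have : b (i + 1) * ((i + 1 : ℝ) * (1 - p)) ≤ 2 * b i * ((i + 1 : ℝ) * (1 - p)) := by
    rw [key]
    nlinarith [hbi, h]
  exact le_of_mul_le_mul_right this hA

/-- One step down: if `(i+1)(1-p) ≤ 2 (N-i) p` then `b i ≤ 2 b (i+1)`. [folklore] -/
theorem binomialWeight_le_two_mul_succ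
    (hb : ∀ i, b i = (N.choose i : ℝ) * p ^ i * (1 - p) ^ (N - i)) (hp0 : 0 < p) (hp1 : p ≤ 1)
    {i : ℕ} (hi : i + 1 ≤ N) (h : (i + 1 : ℝ) * (1 - p) ≤ 2 * (((N : ℝ) - i) * p)) :
    b i ≤ 2 * b (i + 1) := by
  have hNi : (0 : ℝ) < (N : ℝ) - i := by
    have : ((i + 1 : ℕ) : ℝ) ≤ N := by exact_mod_cast hi
    push_cast at this
    linarith
  have hB : 0 < ((N : ℝ) - i) * p := mul_pos hNi hp0
  have hbi : 0 ≤ b (i + 1) := binomialWeight_nonneg hb hp0.le hp1 (i + 1)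
  have key := binomialWeight_succ_mul hb hi
  have : b i * (((N : ℝ) - i) * p) ≤ 2 * b (i + 1) * (((N : ℝ) - i) * p) := by
    rw [← key]
    nlinarith [hbi, h]
  exact le_of_mul_le_mul_right this hB

/-- Iterated step up: on a window where every step condition holds, `b (a + d) ≤ 2^d b a`.
[folklore] -/
theorem binomialWeight_add_le_two_pow_mul
    (hb : ∀ i, b i = (N.choose i : ℝ) * p ^ i * (1 - p) ^ (N - i)) (hp0 : 0 ≤ p) (hp1 : p < 1)
    {a d : ℕ} (had : a + d ≤ N)
    (hup : ∀ t : ℕ, a ≤ t → t < a + d → ((N : ℝ) - t) * p ≤ 2 * ((t + 1 : ℝ) * (1 - p))) :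
    b (a + d) ≤ 2 ^ d * b a := by
  induction d with
  | zero => simp
  | succ d ih =>
    have h1 : b (a + d) ≤ 2 ^ d * b a :=
      ih (by omega) fun t ht1 ht2 => hup t ht1 (by omega)
    have h2 : b (a + d + 1) ≤ 2 * b (a + d) :=
      binomialWeight_succ_le_two_mul hb hp0 hp1 (by omega) (by
        have := hup (a + d) (by omega) (by omega)
        push_cast at this ⊢
        exact this)
    calc b (a + (d + 1)) = b (a + d + 1) := by rw [← add_assoc]
      _ ≤ 2 * b (a + d) := h2
      _ ≤ 2 * (2 ^ d * b a) := by nlinarith [h1]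
      _ = 2 ^ (d + 1) * b a := by ring

/-- Iterated step down: on a window where every step condition holds, `b a ≤ 2^d b (a + d)`.
[folklore] -/
theorem binomialWeight_le_two_pow_mul_add
    (hb : ∀ i, b i = (N.choose i : ℝ) * p ^ i * (1 - p) ^ (N - i)) (hp0 : 0 < p) (hp1 : p ≤ 1)
    {a d : ℕ} (had : a + d ≤ N)
    (hdown : ∀ t : ℕ, a ≤ t → t < a + d → (t + 1 : ℝ) * (1 - p) ≤ 2 * (((N : ℝ) - t) * p)) :
    b a ≤ 2 ^ d * b (a + d) := by
  induction d with
  | zero => simp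
  | succ d ih =>
    have h1 : b a ≤ 2 ^ d * b (a + d) :=
      ih (by omega) fun t ht1 ht2 => hdown t ht1 (by omega)
    have h2 : b (a + d) ≤ 2 * b (a + d + 1) :=
      binomialWeight_le_two_mul_succ hb hp0 hp1 (by omega) (by
        have := hdown (a + d) (by omega) (by omega)
        push_cast at this ⊢
        exact this)
    have h4 : (0 : ℝ) ≤ 2 ^ d := by positivity
    calc b a ≤ 2 ^ d * b (a + d) := h1
      _ ≤ 2 ^ d * (2 * b (a + d + 1)) := mul_le_mul_of_nonneg_left h2 h4
      _ = 2 ^ (d + 1) * b (a + (d + 1)) := by rw [← add_assoc]; ring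

end Binomial

/-! ### Double counting of bands and the weighted-averaging lemma -/

section Averaging

/-- **Double counting of bands**: each index `i ≤ N` lies in at most `2w+1` of the bands
`[j-w, j+w]`, so `∑_{j ∈ S} ∑_{i ∈ [j-w, j+w]} g i ≤ (2w+1) ∑_{i ≤ N} g i` for nonnegative `g`
once every band ends below `N`. [folklore] -/
theorem sum_sum_Icc_le_mul_sum {S : Finset ℕ} {N w : ℕ} {g : ℕ → ℝ} (hg : ∀ i, 0 ≤ g i)
    (hSN : ∀ j ∈ S, j + w ≤ N) :
    ∑ j ∈ S, ∑ i ∈ Icc (j - w) (j + w), g i ≤ (2 * w + 1) * ∑ i ∈ range (N + 1), g i := by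
  rw [Finset.sum_comm' (t' := range (N + 1))
    (s' := fun i => S.filter fun j => i ∈ Icc (j - w) (j + w))]
  · rw [mul_sum]
    refine sum_le_sum fun i _ => ?_
    rw [sum_const, nsmul_eq_mul]
    refine mul_le_mul_of_nonneg_right ?_ (hg i)
    have hsub : (S.filter fun j => i ∈ Icc (j - w) (j + w)) ⊆ Icc (i - w) (i + w) := by
      intro j hj
      have h := (mem_filter.1 hj).2
      rw [mem_Icc] at h ⊢
      omega
    have hcard := card_le_card hsub
    rw [Nat.card_Icc] at hcard
    have : #(S.filter fun j => i ∈ Icc (j - w) (j + w)) ≤ 2 * w + 1 := by omega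
    exact_mod_cast this
  · intro j i
    constructor
    · rintro ⟨hj, hi⟩
      refine ⟨mem_filter.2 ⟨hj, hi⟩, ?_⟩
      have := hSN j hj
      rw [mem_Icc] at hi
      rw [mem_range]
      omega
    · rintro ⟨hj, _⟩
      exact ⟨(mem_filter.1 hj).1, (mem_filter.1 hj).2⟩

/-- **Weighted averaging over the central indices.** Let `b, f ≥ 0`, let the indices of `S` carry
`b`-mass at least `1/2`, let every band `[j-w, j+w]`, `j ∈ S`, end below `N`, and let
`b j ≤ K b i` across each such band. If `∑_{i ≤ N} b i f i ≤ ε` then some `j ∈ S` has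
`∑_{i ∈ [j-w, j+w]} f i ≤ 2 K (2w+1) ε`. [folklore] -/
theorem exists_mem_band_sum_le {S : Finset ℕ} {N w : ℕ} {b f : ℕ → ℝ} {K ε : ℝ}
    (hb : ∀ i, 0 ≤ b i) (hf : ∀ i, 0 ≤ f i) (hK : 0 ≤ K)
    (hS : 1 / 2 ≤ ∑ j ∈ S, b j) (hSN : ∀ j ∈ S, j + w ≤ N)
    (hratio : ∀ j ∈ S, ∀ i ∈ Icc (j - w) (j + w), b j ≤ K * b i)
    (hsum : ∑ i ∈ range (N + 1), b i * f i ≤ ε) :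
    ∃ j ∈ S, ∑ i ∈ Icc (j - w) (j + w), f i ≤ 2 * K * (2 * w + 1) * ε := by
  -- the band sums, and their `b`-weighted total
  set band : ℕ → ℝ := fun j => ∑ i ∈ Icc (j - w) (j + w), f i with hband
  have hSne : S.Nonempty := by
    by_contra h
    rw [not_nonempty_iff_eq_empty] at h
    rw [h, sum_empty] at hS
    norm_num at hS
  obtain ⟨j₀, hj₀S, hj₀⟩ := exists_min_image S band hSne
  refine ⟨j₀, hj₀S, ?_⟩
  have hε : ∑ i ∈ range (N + 1), b i * f i ≤ ε := hsum
  -- total ≤ K (2w+1) ε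
  have htotal : ∑ j ∈ S, b j * band j ≤ K * ((2 * w + 1) * ε) := by
    calc ∑ j ∈ S, b j * band j = ∑ j ∈ S, ∑ i ∈ Icc (j - w) (j + w), b j * f i := by
          refine sum_congr rfl fun j _ => ?_
          rw [hband, mul_sum]
      _ ≤ ∑ j ∈ S, ∑ i ∈ Icc (j - w) (j + w), K * (b i * f i) := by
          refine sum_le_sum fun j hj => sum_le_sum fun i hi => ?_
          have := hratio j hj i hi
          calc b j * f i ≤ K * b i * f i := mul_le_mul_of_nonneg_right this (hf i)
            _ = K * (b i * f i) := by ring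
      _ = K * ∑ j ∈ S, ∑ i ∈ Icc (j - w) (j + w), b i * f i := by
          rw [mul_sum]
          refine sum_congr rfl fun j _ => ?_
          rw [mul_sum]
      _ ≤ K * ((2 * w + 1) * ∑ i ∈ range (N + 1), b i * f i) :=
          mul_le_mul_of_nonneg_left
            (sum_sum_Icc_le_mul_sum (fun i => mul_nonneg (hb i) (hf i)) hSN) hK
      _ ≤ K * ((2 * w + 1) * ε) := by
          refine mul_le_mul_of_nonneg_left (mul_le_mul_of_nonneg_left hε ?_) hK
          positivity
  -- the minimum band sum is at most total / mass
  have hmin : band j₀ * ∑ j ∈ S, b j ≤ ∑ j ∈ S, b j * band j := by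
    rw [mul_sum]
    refine sum_le_sum fun j hj => ?_
    rw [mul_comm]
    exact mul_le_mul_of_nonneg_left (hj₀ j hj) (hb j)
  have hband0 : 0 ≤ band j₀ := sum_nonneg fun i _ => hf i
  have h2 : band j₀ * (1 / 2) ≤ K * ((2 * w + 1) * ε) :=
    (mul_le_mul_of_nonneg_left hS hband0).trans (hmin.trans htotal)
  show band j₀ ≤ 2 * K * (2 * w + 1) * ε
  linarith

end Averaging

end Summit.PneNP.PneNP.Theorems
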